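import Literature.Computability.AlgebraicComplexity.DefinableVNP
import Literature.Computability.AlgebraicComplexity.Bur24PowerSubstitution
import Literature.Computability.AlgebraicComplexity.IMMInVPProofs
import HarnessLib

/-!
# Kronecker packing into Tavenas' generic `VNP` polynomial

Route-independent algebra for the `VPBoundarySquare` `CH`-corner
(`Theorems/VPBoundarySquareCHAlgebraicHalf.lean`), reusing the tree's univariate `VNP`-witness of
Tavenas (`DefVNP.FamilyData`, `DefVNP.hPoly`, `DefVNP.isVNPFamily_hPoly`,
`Literature/…/DefinableVNP*.lean`) for multivariate families:

* §1 **Kronecker packing** `kron D Q = Σ_c coeff(c) Q · Y^{Σ cᵢ Dⁱ}` of `Q ∈ ℤ[X₀,…,X_{u-1}]` with a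
  digit base `D = 2^δ`; coefficient `α` of the packing is the coefficient of the digit vector
  `dig δ u α` (`coeff_kron`, `fs_symm_eq_dig`);
* §2 the **substitution identity** `aeval_theta_hPoly`: if `Φ.f n = kron (2^δ) Qₙ` and
  `Φ.d n = u·δ`, Tavenas' generic polynomial `hPoly Φ n` in the bit variables `x_t`, `z_ℓ`
  specialises to `(map ℤ→k Qₙ)(y)` under `theta : x_{δ i + j} ↦ yᵢ^{2^j}, z_ℓ ↦ 2^{2^ℓ}`
  (Tavenas 2014, (3.1): `Σ_α f_α Y^α = h(Y^{2^0},…,Y^{2^{D-1}}, 2^{2^0},…)`, composed with the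
  Kronecker substitution `Y^{2^{δ i + j}} ↦ Xᵢ^{2^j}`);
* §3 the **cost** of `theta`: `Σ_v L(theta v) ≤ (u·δ)·δ` by repeated squaring
  (`sum_complexity_theta_le`).

[cite: Tavenas2014, Prop. 3.17 and (3.1)] [cite: Burgisser2026HNC, Lemma 4.11 (p. 13)]
-/

noncomputable section

set_option linter.dupNamespace false

open MvPolynomial
open Literature.Computability.AlgebraicComplexity

namespace Summit.ValiantsHypothesis.ValiantsHypothesis.Theorems.VPBoundarySquareKroneckerVNP

/-! ## §1  Kronecker packing with a power-of-two digit base -/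

section Kronecker

variable {u D : ℕ}

/-- The exponent vector whose `i`-th entry is the digit `c i`. -/
def fs (c : Fin u → Fin D) : Fin u →₀ ℕ :=
  Finsupp.equivFunOnFinite.symm fun i => (c i : ℕ)

/-- The entries of `fs c` are the digits `c i`. -/
@[simp] theorem fs_apply (c : Fin u → Fin D) (i : Fin u) : fs c i = (c i : ℕ) := by
  simp [fs]

/-- `fs` is injective. -/
theorem fs_injective : Function.Injective (fs (u := u) (D := D)) := by
  intro c c' h
  funext i
  exact Fin.ext (by simpa using DFunLike.congr_fun h i)

/-- Kronecker packing of a multivariate integer polynomial with digit base `D`: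
the monomial `X^e` with all `e i < D` goes to `Y ^ (Σ i, e i * D ^ i)`. -/
def kron (D : ℕ) (Q : MvPolynomial (Fin u) ℤ) : Polynomial ℤ :=
  ∑ c : Fin u → Fin D, Polynomial.monomial (finFunctionFinEquiv c : ℕ) (coeff (fs c) Q)

/-- Coefficients of the Kronecker packing: coefficient `α < D^u` is the coefficient of the
digit vector of `α`, the others vanish. -/
theorem coeff_kron (Q : MvPolynomial (Fin u) ℤ) (α : ℕ) :
    (kron D Q).coeff α =
      if h : α < D ^ u then coeff (fs (finFunctionFinEquiv.symm ⟨α, h⟩)) Q else 0 := by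
  classical
  rw [kron, Polynomial.finsetSum_coeff]
  simp only [Polynomial.coeff_monomial]
  split_ifs with h
  · rw [Finset.sum_eq_single (finFunctionFinEquiv.symm ⟨α, h⟩)]
    · rw [if_pos (by simp)]
    · intro c _ hc
      rw [if_neg]
      intro hEq
      apply hc
      apply finFunctionFinEquiv.injective
      exact Fin.ext (by simp [hEq])
    · intro h'
      exact absurd (Finset.mem_univ _) h'
  · refine Finset.sum_eq_zero fun c _ => ?_
    rw [if_neg]
    intro hEq
    exact h (hEq ▸ (finFunctionFinEquiv c).isLt)

/-- Coefficients of the Kronecker packing in range. -/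
theorem coeff_kron_of_lt (Q : MvPolynomial (Fin u) ℤ) {α : ℕ} (h : α < D ^ u) :
    (kron D Q).coeff α = coeff (fs (finFunctionFinEquiv.symm ⟨α, h⟩)) Q := by
  rw [coeff_kron, dif_pos h]

/-- Coefficient of the packing at the index with digits `c`. -/
theorem coeff_kron_apply (Q : MvPolynomial (Fin u) ℤ) (c : Fin u → Fin D) :
    (kron D Q).coeff (finFunctionFinEquiv c) = coeff (fs c) Q := by
  rw [coeff_kron_of_lt Q (finFunctionFinEquiv c).isLt, Fin.eta, Equiv.symm_apply_apply]

/-- The packing has degree `< D^u`. -/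
theorem natDegree_kron_lt (Q : MvPolynomial (Fin u) ℤ) (hD : 0 < D ^ u) :
    (kron D Q).natDegree < D ^ u := by
  have h : (kron D Q).natDegree ≤ D ^ u - 1 := by
    rw [Polynomial.natDegree_le_iff_coeff_eq_zero]
    intro N hN
    rw [coeff_kron, dif_neg (by omega)]
  omega

/-- Every coefficient of the packing is a coefficient of `Q` (or zero). -/
theorem natAbs_coeff_kron_le (Q : MvPolynomial (Fin u) ℤ) (α : ℕ) {b : ℕ}
    (hb : ∀ e, (coeff e Q).natAbs < b) : ((kron D Q).coeff α).natAbs < b := by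
  rw [coeff_kron]
  split_ifs with h
  · exact hb _
  · simpa using (Nat.zero_le _).trans_lt (hb 0)

/-- The base-`2^δ` digit vector of `α` (first `u` digits). -/
def dig (δ u α : ℕ) : Fin u →₀ ℕ :=
  Finsupp.equivFunOnFinite.symm fun i => α / (2 ^ δ) ^ (i : ℕ) % 2 ^ δ

/-- The `i`-th base-`2^δ` digit. -/
@[simp] theorem dig_apply (δ u α : ℕ) (i : Fin u) :
    dig δ u α i = α / (2 ^ δ) ^ (i : ℕ) % 2 ^ δ := by
  simp [dig]

/-- For the digit base `2^δ`, decoding an index through `finFunctionFinEquiv` gives `dig`. -/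
theorem fs_symm_eq_dig {δ u α : ℕ} (h : α < (2 ^ δ) ^ u) :
    fs (finFunctionFinEquiv.symm ⟨α, h⟩) = dig δ u α := by
  ext i
  simp [finFunctionFinEquiv_symm_apply_val]

/-- The digit vector of the index with digits `c` is `fs c`. -/
theorem dig_finFunctionFinEquiv {δ u : ℕ} (c : Fin u → Fin (2 ^ δ)) :
    dig δ u (finFunctionFinEquiv c) = fs c := by
  rw [← fs_symm_eq_dig (finFunctionFinEquiv c).isLt, Fin.eta, Equiv.symm_apply_apply]

end Kronecker

/-! ## §2  The substitution identity for Tavenas' generic polynomial -/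

section Substitution

variable {k : Type*} [CommRing k]

/-- Sign times absolute value (Tavenas' sign gadget), over any commutative ring. -/
theorem sgnK_mul_natAbs (a : ℤ) : DefVNP.sgnK k a * (a.natAbs : k) = (a : k) := by
  unfold DefVNP.sgnK
  rw [DefVNP.toK_eq_cast]
  by_cases h : a < 0
  · have h1 : (a.natAbs : k) = -(a : k) := by
      rw [← Int.cast_natCast, show (a.natAbs : ℤ) = -a by omega, Int.cast_neg]
    rw [decide_eq_true h, Bool.toNat_true, Nat.cast_one, h1]
    ring
  · have h1 : (a.natAbs : k) = (a : k) := by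
      rw [← Int.cast_natCast, show (a.natAbs : ℤ) = a by omega]
    rw [decide_eq_false h, Bool.toNat_false, Nat.cast_zero, h1]
    ring

/-- Summing Tavenas' bit coefficients against the powers `2^i` recovers the coefficient. -/
theorem sum_coefK_mul_two_pow (Φ : DefVNP.FamilyData) (n α : ℕ) :
    ∑ eI : Fin (DefVNP.params Φ n).R → Bool,
        DefVNP.coefK (k := k) Φ n α (Nat.ofBits eI) * (2 : k) ^ Nat.ofBits eI =
      (((Φ.f n).coeff α : ℤ) : k) := by
  rw [BoolGadgets.sum_boolVec_eq_sum_range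
    (fun i => DefVNP.coefK (k := k) Φ n α i * (2 : k) ^ i)]
  change ∑ i ∈ Finset.range (2 ^ Φ.r n), _ = _
  unfold DefVNP.coefK
  simp only [DefVNP.toK_eq_cast]
  have hre : ∀ i : ℕ, ((((Φ.f n).coeff α).natAbs.testBit i).toNat : k) *
      DefVNP.sgnK k ((Φ.f n).coeff α) * 2 ^ i =
      DefVNP.sgnK k ((Φ.f n).coeff α) *
        ((2 ^ i * (((Φ.f n).coeff α).natAbs.testBit i).toNat : ℕ) : k) := by
    intro i; push_cast; ring
  simp_rw [hre]
  rw [← Finset.mul_sum, ← Nat.cast_sum, sum_two_pow_mul_testBit_of_lt (Φ.hcoeff n α),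
    sgnK_mul_natAbs]

end Substitution

section Substitution2

variable (k : Type*) [CommRing k] {S : Type*} [CommRing S] [Algebra k S]

/-- The substitution `x_{δ i + j} ↦ yᵢ ^ 2^j`, `z_ℓ ↦ 2^(2^ℓ)` on Tavenas' variables. -/
def theta (Φ : DefVNP.FamilyData) (n : ℕ) {u δ : ℕ} (hd : Φ.d n = u * δ) (y : Fin u → S) :
    DefVNP.XZ (DefVNP.params Φ n) → S :=
  Sum.elim
    (fun t => y (finProdFinEquiv.symm (Fin.cast hd t)).1 ^
      2 ^ ((finProdFinEquiv.symm (Fin.cast hd t)).2 : ℕ))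
    (fun l => algebraMap k S (2 ^ 2 ^ (l : ℕ)))

/-- `theta` on a bit variable `x_{δ i + j}`. -/
@[simp] theorem theta_inl (Φ : DefVNP.FamilyData) (n : ℕ) {u δ : ℕ} (hd : Φ.d n = u * δ)
    (y : Fin u → S) (t : Fin (DefVNP.params Φ n).D) :
    theta k Φ n hd y (Sum.inl t) = y (finProdFinEquiv.symm (Fin.cast hd t)).1 ^
      2 ^ ((finProdFinEquiv.symm (Fin.cast hd t)).2 : ℕ) := rfl

/-- `theta` on a constant variable `z_ℓ`. -/
@[simp] theorem theta_inr (Φ : DefVNP.FamilyData) (n : ℕ) {u δ : ℕ} (hd : Φ.d n = u * δ)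
    (y : Fin u → S) (l : Fin (DefVNP.params Φ n).R) :
    theta k Φ n hd y (Sum.inr l) = algebraMap k S (2 ^ 2 ^ (l : ℕ)) := rfl

/-- The `z`-selector products specialise to the powers `2^i`. -/
theorem aeval_theta_zsel (Φ : DefVNP.FamilyData) (n : ℕ) {u δ : ℕ} (hd : Φ.d n = u * δ)
    (y : Fin u → S) (eI : Fin (DefVNP.params Φ n).R → Bool) :
    aeval (theta k Φ n hd y) (DefVNP.zsel (k := k) (DefVNP.params Φ n) eI) =
      algebraMap k S (2 ^ Nat.ofBits eI) := by
  unfold DefVNP.zsel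
  rw [map_prod]
  have : ∀ t : Fin (DefVNP.params Φ n).R,
      aeval (theta k Φ n hd y) (if eI t then X (Sum.inr t) else (1 : MvPolynomial _ k)) =
        algebraMap k S (2 ^ ((eI t).toNat * 2 ^ (t : ℕ))) := by
    intro t
    cases eI t <;> simp
  simp_rw [this]
  rw [← map_prod, Finset.prod_pow_eq_pow_sum, ← BoolGadgets.ofBits_eq_sum]

/-- The digit `dig δ u α i` in terms of the bits of `α`. -/
theorem sum_bits_eq_dig {u δ : ℕ} {m : ℕ} (hm : m = u * δ) (eA : Fin m → Bool) (i : Fin u) :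
    ∑ j : Fin δ, 2 ^ (j : ℕ) * (eA (Fin.cast hm.symm (finProdFinEquiv (i, j)))).toNat =
      dig δ u (Nat.ofBits eA) i := by
  rw [dig_apply, ← pow_mul, ← sum_two_pow_mul_testBit]
  rw [Finset.sum_range]
  refine Finset.sum_congr rfl fun j _ => ?_
  have hlt : (j : ℕ) + δ * i < m := by
    have := (finProdFinEquiv (i, j)).isLt
    simp only [finProdFinEquiv_apply_val] at this
    rw [hm]; linarith
  congr 2
  rw [Nat.testBit_div_two_pow, Nat.testBit_ofBits_lt _ _ hlt]
  exact congrArg eA (Fin.ext (by simp [finProdFinEquiv_apply_val]))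

/-- The `x`-selector products specialise to the monomials `y ^ dig α`. -/
theorem aeval_theta_xsel (Φ : DefVNP.FamilyData) (n : ℕ) {u δ : ℕ} (hd : Φ.d n = u * δ)
    (y : Fin u → S) (eA : Fin (DefVNP.params Φ n).D → Bool) :
    aeval (theta k Φ n hd y) (DefVNP.xsel (k := k) (DefVNP.params Φ n) eA) =
      ∏ i : Fin u, y i ^ dig δ u (Nat.ofBits eA) i := by
  unfold DefVNP.xsel
  rw [map_prod]
  have h1 : ∀ t : Fin (DefVNP.params Φ n).D,
      aeval (theta k Φ n hd y) (if eA t then X (Sum.inl t) else (1 : MvPolynomial _ k)) =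
        (y (finProdFinEquiv.symm (Fin.cast hd t)).1 ^
          2 ^ ((finProdFinEquiv.symm (Fin.cast hd t)).2 : ℕ)) ^ (eA t).toNat := by
    intro t
    cases eA t <;> simp
  simp_rw [h1]
  -- reindex `t` over `Fin u × Fin δ`
  let e : Fin (DefVNP.params Φ n).D ≃ Fin u × Fin δ :=
    (finCongr hd).trans finProdFinEquiv.symm
  rw [Fintype.prod_equiv e _ (fun p : Fin u × Fin δ =>
      (y p.1 ^ 2 ^ (p.2 : ℕ)) ^ (eA (e.symm p)).toNat) (fun t => by
        rw [Equiv.symm_apply_apply]; rfl)]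
  rw [Fintype.prod_prod_type]
  refine Finset.prod_congr rfl fun i _ => ?_
  simp_rw [← pow_mul]
  rw [Finset.prod_pow_eq_pow_sum]
  exact congrArg (fun m => y i ^ m) (sum_bits_eq_dig hd eA i)

/-- **Substitution identity.**  If `Φ.f n` is the Kronecker packing of `Qn` (digit base `2^δ`,
`Φ.d n = u·δ` bit variables) then Tavenas' generic polynomial specialises to `(map Qn)(y)` under
`theta`. -/
theorem aeval_theta_hPoly (Φ : DefVNP.FamilyData) (n : ℕ) {u δ : ℕ} (hd : Φ.d n = u * δ)
    (Qn : MvPolynomial (Fin u) ℤ) (hf : Φ.f n = kron (2 ^ δ) Qn)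
    (hsupp : ∀ e ∈ Qn.support, ∀ i, e i < 2 ^ δ) (y : Fin u → S) :
    aeval (theta k Φ n hd y) (DefVNP.hPoly (k := k) Φ n) = aeval y (map (Int.castRingHom k) Qn) := by
  classical
  unfold DefVNP.hPoly
  simp_rw [map_sum, map_mul, aeval_C, aeval_theta_xsel, aeval_theta_zsel]
  -- inner sum over the bit index
  have hin : ∀ eA : Fin (DefVNP.params Φ n).D → Bool,
      ∑ eI : Fin (DefVNP.params Φ n).R → Bool,
        algebraMap k S (DefVNP.coefK (k := k) Φ n (Nat.ofBits eA) (Nat.ofBits eI)) *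
          (∏ i : Fin u, y i ^ dig δ u (Nat.ofBits eA) i) * algebraMap k S (2 ^ Nat.ofBits eI) =
      algebraMap k S ((((Φ.f n).coeff (Nat.ofBits eA) : ℤ) : k)) *
        ∏ i : Fin u, y i ^ dig δ u (Nat.ofBits eA) i := by
    intro eA
    rw [← sum_coefK_mul_two_pow (k := k) Φ n (Nat.ofBits eA), map_sum, Finset.sum_mul]
    refine Finset.sum_congr rfl fun eI _ => ?_
    rw [map_mul]
    ring
  simp_rw [hin]
  rw [BoolGadgets.sum_boolVec_eq_sum_range (fun α => algebraMap k S ((((Φ.f n).coeff α : ℤ) : k)) *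
        ∏ i : Fin u, y i ^ dig δ u α i)]
  -- `2 ^ (u δ) = (2^δ)^u`
  have hD : 2 ^ (DefVNP.params Φ n).D = (2 ^ δ) ^ u := by
    show 2 ^ Φ.d n = _
    rw [hd, mul_comm, pow_mul]
  rw [hD, ← Fin.sum_univ_eq_sum_range, ← Equiv.sum_comp finFunctionFinEquiv]
  simp_rw [hf, coeff_kron_apply, dig_finFunctionFinEquiv, fs_apply]
  -- right-hand side
  rw [MvPolynomial.aeval_def, MvPolynomial.eval₂_map, MvPolynomial.eval₂_eq']
  have hsub : Qn.support ⊆ Finset.univ.image (fs (D := 2 ^ δ)) := by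
    intro e he
    refine Finset.mem_image.mpr ⟨fun i => ⟨e i, hsupp e he i⟩, Finset.mem_univ _, ?_⟩
    ext i; simp
  rw [Finset.sum_subset hsub (fun e _ hnot => by
      rw [MvPolynomial.notMem_support_iff.mp hnot, map_zero, zero_mul])]
  rw [Finset.sum_image (fun c _ c' _ h => fs_injective h)]
  refine Finset.sum_congr rfl fun c _ => ?_
  simp only [eq_intCast, fs_apply]
  congr 1
  rw [← map_intCast (algebraMap k S)]

end Substitution2

/-! ## §3  Circuit cost of the substitution -/

section Cost

variable {k : Type*} [CommRing k]

/-- Repeated squaring: `L(q ^ 2^ℓ) ≤ L(q) + ℓ`. -/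
theorem complexity_pow_two_pow_le {σ : Type*} (q : MvPolynomial σ k) (ℓ : ℕ) :
    complexity (q ^ 2 ^ ℓ) ≤ complexity q + ℓ := by
  have h := complexity_aeval_le ((X () : MvPolynomial Unit k) ^ 2 ^ ℓ) (fun _ => q)
  simp only [map_pow, aeval_X, Finset.univ_unique, Finset.sum_singleton] at h
  have h2 := complexity_X_pow_two_pow_le (k := k) (ρ := Unit) () ℓ
  omega

/-- The substituted inputs `X i` and constants `C c` are free. -/
theorem complexity_append_X_C {w m : ℕ} (c : Fin m → k) (i : Fin (w + m)) :
    complexity (Fin.append (X : Fin w → MvPolynomial (Fin w) k) (fun j => C (c j)) i) = 0 := by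
  induction i using Fin.addCases with
  | left i => rw [Fin.append_left]; exact complexity_X_holds i
  | right j => rw [Fin.append_right]; exact complexity_C_holds (c j)

/-- Total cost of the substitution `theta`: at most `(u·δ)·δ` (each `yᵢ^{2^j}` costs `j < δ` squarings,
the constants `2^{2^ℓ}` are free). -/
theorem sum_complexity_theta_le (Φ : DefVNP.FamilyData) (n : ℕ) {u δ : ℕ} (hd : Φ.d n = u * δ)
    {τ : Type*} (y : Fin u → MvPolynomial τ k) (hy : ∀ i, complexity (y i) = 0) :
    ∑ v, complexity (theta k Φ n hd y v) ≤ Φ.d n * δ := by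
  rw [Fintype.sum_sum_type]
  have h1 : ∑ t : Fin (DefVNP.params Φ n).D, complexity (theta k Φ n hd y (Sum.inl t)) ≤
      Φ.d n * δ := by
    calc ∑ t : Fin (DefVNP.params Φ n).D, complexity (theta k Φ n hd y (Sum.inl t))
        ≤ ∑ _t : Fin (DefVNP.params Φ n).D, δ := Finset.sum_le_sum fun t _ => by
          rw [theta_inl]
          refine (complexity_pow_two_pow_le _ _).trans ?_
          rw [hy, zero_add]
          exact (Fin.is_lt _).le
      _ = Φ.d n * δ := by
          rw [Finset.sum_const, Finset.card_univ, Fintype.card_fin, smul_eq_mul]; rfl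
  have h2 : ∑ l : Fin (DefVNP.params Φ n).R, complexity (theta k Φ n hd y (Sum.inr l)) = 0 := by
    refine Finset.sum_eq_zero fun l _ => ?_
    rw [theta_inr, MvPolynomial.algebraMap_eq]
    exact complexity_C_holds _
  omega

end Cost

end Summit.ValiantsHypothesis.ValiantsHypothesis.Theorems.VPBoundarySquareKroneckerVNP
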